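import Mathlib
import Literature.Analysis.FluidPDE.VectorCalculus

/-!
# `SkeletonEquilibrium` (stmt-NavierStokesRegularity-15400): a witness is necessarily half-turn-chiral (dihedral exclusion)

Negative-side structural helper for the (held) support item `FilamentSkeletonRss.SkeletonEquilibrium`
(`--supports stmt-NavierStokesRegularity-15400`), completing the symmetry exclusions of
`…HelixExclusion` (p830741) and `…HalfTurnExclusion` (p830830) to WHOLE CONFIGURATIONS.

Setting. `N` differentiable filaments `Ξ_k`, circulation ratios `γ_k`, the crux's regularised Biot–Savart
induction `u(x) = Σ_k (Γγ_k/4π) ∫ ((‖x − Ξ_k σ‖² + 1)^{3/2})⁻¹ • Ξ_k′σ × (x − Ξ_k σ) dσ`, and a marked point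
`x* = Ξ_j(0)` of filament `j`. Let `ρ` be the HALF-TURN about the horizontal radial line through `x*`
(after a rotation about `e₃`, `x* = (a, 0, z₀)` and `ρ(x, y, z) = (x, −y, 2z₀ − z)`). Suppose the oriented,
weighted configuration is `ρ`-symmetric up to an involutive relabelling `π` of the filaments fixing `j`:
`Ξ_{π k}(−σ) = ρ(Ξ_k(σ))` (coordinates: hypothesis `hsym`) and `γ_{π k} = γ_k`. This is exactly DIHEDRAL
data: e.g. every `C_N`-orbit of ONE half-turn-symmetric strand with equal circulations (`π k = 2j − k`), in
particular every `C_N`-symmetric configuration of straight lines (a line is half-turn symmetric about the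
radial line through its point closest to the axis) — the route's inner data (2001 `C₃` triple, the `C₄`
quartets of the `Sketch`/birth lines) are of this kind.

* `deriv_apply_neg_of_affine_relation` — transport of an affine coordinate relation between two curves,
  `Y(−σ)ᵢ = s·X(σ)ᵢ + t ⇒ Y′(−σ)ᵢ = −s·X′(σ)ᵢ`.
* `integral_inner_partner_eq_neg` — for a `ρ`-related pair, the radial components of the inductions at `x*`
  are OPPOSITE: `∫ ⟪e₀, F_{πk}⟫ = −∫ ⟪e₀, F_k⟫` (substitute `σ ↦ −σ`; `ρ` is a rotation fixing `x*` and `e₀`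
  and reverses orientations).
* `sum_radial_induction_eq_zero_of_dihedral` — hence the TOTAL induction at `x*` has zero radial component
  (reindex the sum by the involution `π`; the integrability clause of the crux is used to pass `⟪e₀, ·⟫`
  under the integral).
* `marked_point_on_axis_of_dihedral` — if moreover the tangency clause of the crux holds at `(j, 0)`, then
  `a = (Ξ_j 0)₀ = 0`: the marked point lies ON THE ROTATION AXIS (radial component of the identity:
  `0 + a/2 − 0 = w·(Ξ_j′0)₀ = 0`). So for `N ≥ 2` (two filaments through the same axis point violate the
  separation clause) and for `N = 1` off the axis, NO dihedral configuration is a relative equilibrium —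
  not even radially at one point: every witness of `SkeletonEquilibrium` is HALF-TURN-CHIRAL. (Consistent
  with the outer balance: the profile ODE `Y″ = g Y′ × AY`, `A = ½ − αJ`, is reversible under the improper
  `σ_z`, not under half-turns, which flip `α ↦ −α`, `g ↦ −g`.)
* `not_tangent_of_dihedral` — contrapositive packaging: `a ≠ 0` ⇒ the identity at `(j,0)` fails for every slip
  value.

Def-free (symmetry = coordinate hypotheses; `π` a bare involution on `Fin N`); Mathlib +
`Literature.Analysis.FluidPDE.VectorCalculus` (`cross`) only; no route file imported.
-/

-- `NavierStokesRegularity.NavierStokesRegularity` is the summit/problem path (D-0017), flagged by dupNamespace.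
set_option linter.dupNamespace false

namespace Summit.NavierStokesRegularity.NavierStokesRegularity.Theorems.SkeletonEquilibrium.DihedralExclusion

open Literature.Analysis.FluidPDE MeasureTheory Filter
open scoped RealInnerProductSpace InnerProductSpace BigOperators Topology

/-- Radial (`0`-th) component of the cross product `v × w`. [folklore] -/
private theorem cross_apply_zero (v w : EuclideanSpace ℝ (Fin 3)) :
    cross v w 0 = v 1 * w 2 - v 2 * w 1 := by
  simp [cross, cross_apply]

/-- `⟪e₀, v⟫ = v 0`. [folklore] -/
private theorem inner_single_zero_left (v : EuclideanSpace ℝ (Fin 3)) :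
    ⟪EuclideanSpace.single (0 : Fin 3) (1 : ℝ), v⟫ = v 0 := by
  rw [EuclideanSpace.inner_single_left]; simp

/-- Components of `e₂ = EuclideanSpace.single 2 1`: `e₂ 1 = 0`. [folklore] -/
private theorem single_two_apply_one : (EuclideanSpace.single (2 : Fin 3) (1 : ℝ)) 1 = 0 := by simp

/-- Components of `e₂ = EuclideanSpace.single 2 1`: `e₂ 2 = 1`. [folklore] -/
private theorem single_two_apply_two : (EuclideanSpace.single (2 : Fin 3) (1 : ℝ)) 2 = 1 := by simp

/-- The coordinate functions of a differentiable curve in `ℝ³` are differentiable with derivative the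
coordinate of the velocity. [folklore] -/
private theorem hasDerivAt_apply {Ξ : ℝ → EuclideanSpace ℝ (Fin 3)} (hd : Differentiable ℝ Ξ)
    (i : Fin 3) (σ : ℝ) : HasDerivAt (fun σ' => Ξ σ' i) (deriv Ξ σ i) σ := by
  have h := ((EuclideanSpace.proj i : EuclideanSpace ℝ (Fin 3) →L[ℝ] ℝ).hasFDerivAt).comp_hasDerivAt σ
    (hd σ).hasDerivAt
  exact h

/-- **Transport of an affine coordinate relation between two curves to their velocities.** If
`Y(−σ)ᵢ = s·X(σ)ᵢ + t` for all `σ` (differentiable `X, Y`, one coordinate `i`, constants `s, t`), then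
`Y′(−σ)ᵢ = −s·X′(σ)ᵢ`. [folklore] -/
theorem deriv_apply_neg_of_affine_relation {X Y : ℝ → EuclideanSpace ℝ (Fin 3)}
    (hX : Differentiable ℝ X) (hY : Differentiable ℝ Y) (i : Fin 3) (s t : ℝ)
    (h : ∀ σ, Y (-σ) i = s * X σ i + t) (σ : ℝ) :
    deriv Y (-σ) i = -(s * deriv X σ i) := by
  have h1 : HasDerivAt (fun σ' => Y (-σ') i) (deriv Y (-σ) i * (-1)) σ := by
    have hc := (hasDerivAt_apply hY i (-σ)).comp σ (hasDerivAt_neg σ)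
    simpa [Function.comp_def] using hc
  have h2 : HasDerivAt (fun σ' => Y (-σ') i) (s * deriv X σ i) σ := by
    have hb := ((hasDerivAt_apply hX i σ).const_mul s).add_const t
    refine hb.congr_of_eventuallyEq (Eventually.of_forall fun σ' => ?_)
    simp [h σ']
  have hu := h1.unique h2
  linarith

section Dihedral

variable {N : ℕ} {z₀ : ℝ} {Ξ : Fin N → ℝ → EuclideanSpace ℝ (Fin 3)} {j : Fin N} {π : Fin N → Fin N}
  (hd : ∀ k, Differentiable ℝ (Ξ k)) (hπj : π j = j)
  (hsym : ∀ k σ, Ξ (π k) (-σ) 0 = Ξ k σ 0 ∧ Ξ (π k) (-σ) 1 = -(Ξ k σ 1) ∧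
    Ξ (π k) (-σ) 2 = 2 * z₀ - Ξ k σ 2)
include hπj hsym

/-- The marked point lies on the symmetry axis: `Ξ_j(0) = ((Ξ_j 0)₀, 0, z₀)`. [folklore] -/
theorem apply_zero_of_dihedral : Ξ j 0 1 = 0 ∧ Ξ j 0 2 = z₀ := by
  obtain ⟨_, h1, h2⟩ := hsym j 0
  rw [neg_zero, hπj] at h1 h2
  constructor <;> linarith

/-- The chord lengths from the marked point to `ρ`-related points agree:
`‖Ξ_j 0 − Ξ_{πk}(−σ)‖ = ‖Ξ_j 0 − Ξ_k σ‖` (`ρ` is an isometry fixing `Ξ_j 0`). [folklore] -/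
private theorem norm_chord_partner (k : Fin N) (σ : ℝ) :
    ‖Ξ j 0 - Ξ (π k) (-σ)‖ = ‖Ξ j 0 - Ξ k σ‖ := by
  obtain ⟨h01, h02⟩ := apply_zero_of_dihedral hπj hsym
  obtain ⟨hn0, hn1, hn2⟩ := hsym k σ
  rw [EuclideanSpace.norm_eq, EuclideanSpace.norm_eq]
  congr 1
  simp only [Fin.sum_univ_three, PiLp.sub_apply, h01, h02, hn0, hn1, hn2, Real.norm_eq_abs, sq_abs]
  ring

include hd

/-- In particular the tangent of filament `j` at the marked point is orthogonal to the symmetry axis: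
`(Ξ_j′ 0)₀ = 0`. [folklore] -/
theorem deriv_zero_apply_zero_of_dihedral : deriv (Ξ j) 0 0 = 0 := by
  have h := deriv_apply_neg_of_affine_relation (hd j) (hd j) 0 1 0
    (fun σ' => by have := (hsym j σ').1; rw [hπj] at this; rw [this]; ring) 0
  rw [neg_zero] at h
  linarith

/-- Pointwise partner antisymmetry of the radial integrand: at parameter `−σ` on filament `π k` the
`e₀`-component of the crux's induction integrand (for the field point `Ξ_j 0`) is MINUS that at parameter
`σ` on filament `k`. [folklore] -/
private theorem inner_integrand_partner (k : Fin N) (σ : ℝ) :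
    ⟪EuclideanSpace.single (0 : Fin 3) (1 : ℝ),
      ((‖Ξ j 0 - Ξ (π k) (-σ)‖ ^ 2 + 1) ^ (3 / 2 : ℝ))⁻¹ •
        cross (deriv (Ξ (π k)) (-σ)) (Ξ j 0 - Ξ (π k) (-σ))⟫ =
      -⟪EuclideanSpace.single (0 : Fin 3) (1 : ℝ),
        ((‖Ξ j 0 - Ξ k σ‖ ^ 2 + 1) ^ (3 / 2 : ℝ))⁻¹ • cross (deriv (Ξ k) σ) (Ξ j 0 - Ξ k σ)⟫ := by
  obtain ⟨h01, h02⟩ := apply_zero_of_dihedral hπj hsym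
  obtain ⟨_, hn1, hn2⟩ := hsym k σ
  have hd1 : deriv (Ξ (π k)) (-σ) 1 = deriv (Ξ k) σ 1 := by
    have h := deriv_apply_neg_of_affine_relation (hd k) (hd (π k)) 1 (-1) 0
      (fun σ' => by rw [(hsym k σ').2.1]; ring) σ
    linarith
  have hd2 : deriv (Ξ (π k)) (-σ) 2 = deriv (Ξ k) σ 2 := by
    have h := deriv_apply_neg_of_affine_relation (hd k) (hd (π k)) 2 (-1) (2 * z₀)
      (fun σ' => by rw [(hsym k σ').2.2]; ring) σ
    linarith
  rw [norm_chord_partner hπj hsym k σ, real_inner_smul_right, real_inner_smul_right,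
    inner_single_zero_left, inner_single_zero_left, cross_apply_zero, cross_apply_zero]
  simp only [PiLp.sub_apply, h01, h02, hn1, hn2, hd1, hd2]
  ring

/-- **Partner antisymmetry of the radial induction.** For a `ρ`-related pair of filaments `(k, π k)` the
radial components at `Ξ_j 0` of their (scalar-integrated) inductions are opposite:
`∫ ⟪e₀, F_{πk}(σ)⟫ dσ = −∫ ⟪e₀, F_k(σ)⟫ dσ` (change of variables `σ ↦ −σ`; no integrability needed for this
scalar form). For `k = j = π j` this is the self-strand statement of `…HalfTurnExclusion`. [folklore] -/
theorem integral_inner_partner_eq_neg (k : Fin N) :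
    ∫ σ : ℝ, ⟪EuclideanSpace.single (0 : Fin 3) (1 : ℝ),
        ((‖Ξ j 0 - Ξ (π k) σ‖ ^ 2 + 1) ^ (3 / 2 : ℝ))⁻¹ •
          cross (deriv (Ξ (π k)) σ) (Ξ j 0 - Ξ (π k) σ)⟫ =
      -∫ σ : ℝ, ⟪EuclideanSpace.single (0 : Fin 3) (1 : ℝ),
        ((‖Ξ j 0 - Ξ k σ‖ ^ 2 + 1) ^ (3 / 2 : ℝ))⁻¹ • cross (deriv (Ξ k) σ) (Ξ j 0 - Ξ k σ)⟫ := by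
  rw [← integral_neg, ← integral_neg_eq_self _ volume]
  exact integral_congr_ae (Eventually.of_forall fun σ => inner_integrand_partner hd hπj hsym k σ)

/-- **The total induction at the marked point of a dihedral configuration has zero radial component.**
With the involution `π` (`π ∘ π = id`), equal circulation ratios on `ρ`-related filaments
(`γ (π k) = γ k`) and the integrability clause of the crux at the field point `Ξ_j 0`, the `e₀`-component of
`Σ_k (Γγ_k/4π) • ∫ F_k` vanishes (reindex the sum by `π` and use `integral_inner_partner_eq_neg`).
[folklore] -/
theorem sum_radial_induction_eq_zero_of_dihedral (hπ : ∀ k, π (π k) = k) (γ : Fin N → ℝ)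
    (hγ : ∀ k, γ (π k) = γ k) (Γ : ℝ)
    (hint : ∀ k, Integrable (fun σ : ℝ => ((‖Ξ j 0 - Ξ k σ‖ ^ 2 + 1) ^ (3 / 2 : ℝ))⁻¹ •
      cross (deriv (Ξ k) σ) (Ξ j 0 - Ξ k σ))) :
    ⟪EuclideanSpace.single (0 : Fin 3) (1 : ℝ), ∑ k : Fin N, (Γ * γ k / (4 * Real.pi)) • ∫ σ : ℝ,
        ((‖Ξ j 0 - Ξ k σ‖ ^ 2 + 1) ^ (3 / 2 : ℝ))⁻¹ • cross (deriv (Ξ k) σ) (Ξ j 0 - Ξ k σ)⟫ = 0 := by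
  -- scalar radial integrals
  set I : Fin N → ℝ := fun k => ∫ σ : ℝ, ⟪EuclideanSpace.single (0 : Fin 3) (1 : ℝ),
    ((‖Ξ j 0 - Ξ k σ‖ ^ 2 + 1) ^ (3 / 2 : ℝ))⁻¹ • cross (deriv (Ξ k) σ) (Ξ j 0 - Ξ k σ)⟫ with hI
  have hIk : ∀ k, ⟪EuclideanSpace.single (0 : Fin 3) (1 : ℝ), ∫ σ : ℝ,
      ((‖Ξ j 0 - Ξ k σ‖ ^ 2 + 1) ^ (3 / 2 : ℝ))⁻¹ • cross (deriv (Ξ k) σ) (Ξ j 0 - Ξ k σ)⟫ = I k := by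
    intro k; rw [hI, ← integral_inner (hint k)]
  have hanti : ∀ k, I (π k) = -I k := fun k => integral_inner_partner_eq_neg hd hπj hsym k
  simp_rw [inner_sum, real_inner_smul_right, hIk]
  -- reindex by the involution π
  have hbij : Function.Bijective π := Function.Involutive.bijective hπ
  have hre : ∑ k : Fin N, Γ * γ k / (4 * Real.pi) * I k =
      ∑ k : Fin N, Γ * γ (π k) / (4 * Real.pi) * I (π k) :=
    (Fintype.sum_bijective π hbij (fun k => Γ * γ (π k) / (4 * Real.pi) * I (π k))
      (fun k => Γ * γ k / (4 * Real.pi) * I k) (fun k => rfl)).symm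
  have hneg : ∑ k : Fin N, Γ * γ (π k) / (4 * Real.pi) * I (π k) =
      -∑ k : Fin N, Γ * γ k / (4 * Real.pi) * I k := by
    rw [← Finset.sum_neg_distrib]
    refine Finset.sum_congr rfl fun k _ => ?_
    rw [hγ k, hanti k]; ring
  linarith

/-- **Dihedral configurations are relative equilibria only with the marked point on the axis.** If, in
addition, the tangency clause of `SkeletonEquilibrium` holds at `(j, τ = 0)` (any `Γ`, `α`, slip value `w₀`),
then `(Ξ_j 0)₀ = 0`, i.e. `Ξ_j(0) = (0, 0, z₀)` lies on the rotation axis: the radial component of the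
identity reads `0 + (Ξ_j 0)₀/2 − 0 = w₀ · (Ξ_j′ 0)₀ = 0`. Hence (separation clause) no dihedral configuration
with `N ≥ 2`, and no off-axis dihedral single filament, is a witness: a `SkeletonEquilibrium` witness is
half-turn-chiral. [folklore] -/
theorem marked_point_on_axis_of_dihedral (hπ : ∀ k, π (π k) = k) (γ : Fin N → ℝ)
    (hγ : ∀ k, γ (π k) = γ k) (Γ α w₀ : ℝ)
    (hint : ∀ k, Integrable (fun σ : ℝ => ((‖Ξ j 0 - Ξ k σ‖ ^ 2 + 1) ^ (3 / 2 : ℝ))⁻¹ •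
      cross (deriv (Ξ k) σ) (Ξ j 0 - Ξ k σ)))
    (heq : (∑ k : Fin N, (Γ * γ k / (4 * Real.pi)) • ∫ σ : ℝ,
        ((‖Ξ j 0 - Ξ k σ‖ ^ 2 + 1) ^ (3 / 2 : ℝ))⁻¹ • cross (deriv (Ξ k) σ) (Ξ j 0 - Ξ k σ)) +
        (1 / 2 : ℝ) • Ξ j 0 - α • cross (EuclideanSpace.single (2 : Fin 3) (1 : ℝ)) (Ξ j 0) =
        w₀ • deriv (Ξ j) 0) :
    Ξ j 0 0 = 0 := by
  have key := congrArg (fun v => ⟪EuclideanSpace.single (0 : Fin 3) (1 : ℝ), v⟫) heq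
  obtain ⟨h01, _⟩ := apply_zero_of_dihedral hπj hsym
  have hd0 := deriv_zero_apply_zero_of_dihedral hd hπj hsym
  have hS := sum_radial_induction_eq_zero_of_dihedral hd hπj hsym hπ γ hγ Γ hint
  simp only [inner_sub_right, inner_add_right, hS, real_inner_smul_right, zero_add,
    inner_single_zero_left, cross_apply_zero, single_two_apply_one, single_two_apply_two, h01, hd0,
    zero_mul, mul_zero, sub_zero] at key
  linarith

/-- Contrapositive packaging: off the axis (`(Ξ_j 0)₀ ≠ 0`) the tangency identity of the crux at `(j, 0)`
fails for EVERY slip value, whatever `Γ` and `α`. [folklore] -/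
theorem not_tangent_of_dihedral (hπ : ∀ k, π (π k) = k) (γ : Fin N → ℝ)
    (hγ : ∀ k, γ (π k) = γ k) (Γ α w₀ : ℝ) (ha : Ξ j 0 0 ≠ 0)
    (hint : ∀ k, Integrable (fun σ : ℝ => ((‖Ξ j 0 - Ξ k σ‖ ^ 2 + 1) ^ (3 / 2 : ℝ))⁻¹ •
      cross (deriv (Ξ k) σ) (Ξ j 0 - Ξ k σ))) :
    (∑ k : Fin N, (Γ * γ k / (4 * Real.pi)) • ∫ σ : ℝ,
        ((‖Ξ j 0 - Ξ k σ‖ ^ 2 + 1) ^ (3 / 2 : ℝ))⁻¹ • cross (deriv (Ξ k) σ) (Ξ j 0 - Ξ k σ)) +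
        (1 / 2 : ℝ) • Ξ j 0 - α • cross (EuclideanSpace.single (2 : Fin 3) (1 : ℝ)) (Ξ j 0) ≠
        w₀ • deriv (Ξ j) 0 :=
  fun h => ha (marked_point_on_axis_of_dihedral hd hπj hsym hπ γ hγ Γ α w₀ hint h)

end Dihedral

end Summit.NavierStokesRegularity.NavierStokesRegularity.Theorems.SkeletonEquilibrium.DihedralExclusion
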